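import Literature.NumberTheory.Automorphic.SmoothIndTraceKernelDiagonal
import Literature.NumberTheory.Automorphic.TDGroupTestFunctions
import HarnessLib

/-!
# `tr T = ∫_K K(k, k) dk` for an endomorphism of `(Ind_H^G σ)^{K′}` computed by an integral kernel on `K`
# (van Dijk 1972, Thm. p. 237 — the step «trace of the integral operator = integral of the kernel over the diagonal»)

Topic `NumberTheory/Automorphic`; namespace `Representation`.  THEOREMS ONLY (no definition, no instance, no notation, no named fact, no `sorry`).  Cell
`pub/hodgecm-mathlib`, line «CMCharIdentityTest» — brick VD-4 (INTEGRAL currency) of the `stub_vanDijkGL` road (census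
`B-provers/B-p18/g31/CENSUS-VD-vanDijkGL-road.B-p18g31.md`), the form the kernel brick VD-3 and the unfolding brick VD-5 consume: over ★ VD-4 (finite form)
`Representation.trace_eq_sum_kernel_diag` and ★ `integral_mul_eq_finset_sum` (`∫ f Φ = μ(K′) Σ_q f(q̃)Φ(q̃)` for right-`K′`-invariant `f, Φ`).

THE STATEMENT (`trace_eq_integral_kernel_diag`).  `G = H · K`, `K′ ≤ K` open with `K′` compact, `σ` a character of `H` on `ℂ`, `μ_K` a left-invariant measure on
`K` finite on compacts, `K ⧸ K′` finite.  If an endomorphism `T` of `V^{K′} = (Ind_H^G σ)^{K′}` is computed by a kernel `K : K → K → ℂ` —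
`(T φ)(κ) = ∫_K K(κ, x) φ(x) dμ_K(x)` — which is right-`K′`-invariant in each variable and `(H ∩ K, σ)`-equivariant in the first, then **`tr T = ∫_K K(x, x) dμ_K(x)`**.
With `T = π(f)|_{V^{K′}}` (★ `levelActOp`, ★ `smoothTrace_eq_trace_levelActOp`) and `K = K_f`, `K_f(k₁,k₂) = c∫_P f(k₁⁻¹pk₂)τ(p)dp` (VD-3), this is van Dijk's
«`tr π(f) = ∫_K K_f(k,k) dk`».
HONEST LABEL: HC_CM is proved only modulo the printed citations (2 remaining named inputs hLiu418, h413) until rung 0 closes; this file is linear algebra + Haar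
bookkeeping on a compact group and pays no letter by itself.

## References
* [vanDijk1972] G. van Dijk, *Computation of certain induced characters of 𝔭-adic groups*, Math. Ann. 199 (1972), 229–240, Thm. p. 237.
* [BernsteinZelevinsky1977] I. N. Bernstein, A. V. Zelevinsky, *Induced representations of reductive 𝔭-adic groups I*, §2.3.
* [Bump1997] D. Bump, *Automorphic Forms and Representations* (1997), §4.4 pp. 458–459.
-/

set_option autoImplicit false

noncomputable section

open MeasureTheory Literature.NumberTheory.Automorphic
open scoped BigOperators

namespace Representation

variable {G : Type*} [Group G] [TopologicalSpace G] [IsTopologicalGroup G] (H K : Subgroup G) (σ : Representation ℂ H ℂ) (K' : Subgroup G)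

variable {H K σ K'} in
/-- **`tr T = ∫_K K(x,x) dμ_K` for an endomorphism of `(Ind_H^G σ)^{K′}` computed by an integral kernel on `K`** (`G = H · K`; `K′ ≤ K` open and compact; the
kernel right-`K′`-invariant in both variables and `(H ∩ K, σ)`-equivariant in the first; `μ_K` left-invariant, finite on compacts; `K ⧸ K′` finite).
[cite: vanDijk1972, Thm. p. 237] [cite: BernsteinZelevinsky1977, §2.3] [cite: Bump1997, §4.4 pp. 458–459] -/
theorem trace_eq_integral_kernel_diag [Fintype (↥K ⧸ K'.subgroupOf K)] [MeasurableSpace ↥K] [BorelSpace ↥K]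
    (μK : Measure ↥K) [μK.IsMulLeftInvariant] [IsFiniteMeasureOnCompacts μK]
    (hK'o : IsOpen (K' : Set G)) (hK'K : K' ≤ K) (hK'c : IsCompact ((K'.subgroupOf K : Subgroup ↥K) : Set ↥K))
    (hGK : ∀ g : G, ∃ h : H, ∃ κ ∈ K, g = h * κ)
    (T : ↥((smoothIndRep H σ).fixedPoints K') →ₗ[ℂ] ↥((smoothIndRep H σ).fixedPoints K'))
    (Kf : ↥K → ↥K → ℂ)
    (hKf₁ : ∀ k' ∈ K'.subgroupOf K, ∀ κ x : ↥K, Kf (κ * k') x = Kf κ x)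
    (hKf₂ : ∀ k' ∈ K'.subgroupOf K, ∀ κ x : ↥K, Kf κ (x * k') = Kf κ x)
    (hKfH : ∀ (p : K) (hp : (p : G) ∈ H) (κ x : ↥K), Kf (p * κ) x = σ ⟨(p : G), hp⟩ 1 * Kf κ x)
    (hT : ∀ (φ : ↥((smoothIndRep H σ).fixedPoints K')) (κ : K),
      ((T φ : ↥((smoothIndRep H σ).fixedPoints K')) : SmoothInd H σ).toFun (κ : G) = ∫ x : ↥K, Kf κ x * (φ : SmoothInd H σ).toFun (x : G) ∂μK) :
    LinearMap.trace ℂ _ T = ∫ x : ↥K, Kf x x ∂μK := by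
  classical
  have hK'o' : IsOpen ((K'.subgroupOf K : Subgroup ↥K) : Set ↥K) := by
    rw [Subgroup.coe_subgroupOf]
    exact hK'o.preimage continuous_subtype_val
  -- the finite kernel on `K ⧸ K′`
  set A : ↥K ⧸ K'.subgroupOf K → ↥K ⧸ K'.subgroupOf K → ℂ := fun y y' => μK.real ((K'.subgroupOf K : Subgroup ↥K) : Set ↥K) * Kf y.out y'.out
    with hA
  -- representatives: `(⟦κ⟧).out = κ k′`
  have hout : ∀ κ : ↥K, ∃ k' ∈ K'.subgroupOf K, (QuotientGroup.mk κ : ↥K ⧸ K'.subgroupOf K).out = κ * k' := fun κ => by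
    obtain ⟨k', hk'⟩ := QuotientGroup.mk_out_eq_mul (K'.subgroupOf K) κ
    exact ⟨k', k'.2, hk'⟩
  have hAout : ∀ (κ : ↥K) (y' : ↥K ⧸ K'.subgroupOf K),
      A (QuotientGroup.mk κ) y' = μK.real ((K'.subgroupOf K : Subgroup ↥K) : Set ↥K) * Kf κ y'.out := fun κ y' => by
    obtain ⟨k', hk', hk⟩ := hout κ
    simp only [hA]
    rw [hk, hKf₁ k' hk']
  -- right-`K′`-invariance of `φ|_K` for `φ ∈ V^{K′}`
  have hφK : ∀ (φ : ↥((smoothIndRep H σ).fixedPoints K')) (k' : ↥K), k' ∈ K'.subgroupOf K → ∀ x : ↥K,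
      (φ : SmoothInd H σ).toFun ((x * k' : ↥K) : G) = (φ : SmoothInd H σ).toFun (x : G) := fun φ k' hk' x => by
    rw [Subgroup.coe_mul]
    exact (mem_fixedPoints_smoothIndRep_iff H K' σ (φ : SmoothInd H σ)).1 φ.2 _ (Subgroup.mem_subgroupOf.1 hk') _
  rw [trace_eq_sum_kernel_diag (K := K) (σ := σ) hK'o hK'K hGK T A ?_ ?_]
  · -- `Σ_y A y y = ∫_K Kf(x,x)`
    have hint := integral_mul_eq_finset_sum μK hK'o' hK'c (f := fun x => Kf x x) (K := K'.subgroupOf K) (C := Finset.univ) (Φ := fun _ => (1 : ℂ))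
        (fun k' hk' x => by show Kf (x * k') (x * k') = Kf x x; rw [hKf₁ k' hk', hKf₂ k' hk']) (fun x _ => Finset.mem_univ _) (fun _ _ _ => rfl)
    have h1 : (fun x : ↥K => Kf x x * (fun _ : ↥K => (1 : ℂ)) x) = fun x => Kf x x := funext fun x => mul_one _
    rw [h1] at hint
    rw [hint]
    refine Finset.sum_congr rfl fun y _ => ?_
    rw [hA, mul_one]
  · -- equivariance of `A` in the first variable
    intro p hp κ y'
    rw [hAout, hAout, hKfH p hp κ, mul_left_comm]
  · -- `T` is computed by `A`
    intro φ κ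
    rw [hT φ κ, integral_mul_eq_finset_sum μK hK'o' hK'c (f := fun x => Kf κ x) (K := K'.subgroupOf K) (C := Finset.univ)
        (Φ := fun x : ↥K => (φ : SmoothInd H σ).toFun (x : G)) (fun k' hk' x => hKf₂ k' hk' κ x) (fun x _ => Finset.mem_univ _)
        (fun k' hk' x => hφK φ k' hk' x)]
    refine Finset.sum_congr rfl fun y' _ => ?_
    rw [hAout, mul_assoc]

/-- The diagonal integral with the trivial factor removed: `∫ Kf x x * 1 = ∫ Kf x x` (bookkeeping form used above, recorded for consumers).
[cite: Bump1997, §4.4 pp. 458–459] -/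
theorem integral_mul_one_eq {X : Type*} [MeasurableSpace X] (μ : Measure X) (F : X → ℂ) : ∫ x, F x * 1 ∂μ = ∫ x, F x ∂μ := by
  simp only [mul_one]

end Representation

end
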